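import Mathlib

/-!
# R29 «SATELLITE LINES — THE B235 PENCIL THROUGH THE BLOB₂ LETTERS» — kernel companion

OURS · L1 W4.5b · IDEATOR 1 (res-L1-w45b-idea-1 gen 37) · crux EL♮(3) = stmt-ResolutionOfSingularities-20148 · counted 0 ·
EL♮(3) is NOT proved here or anywhere in this file · AI-written, weaker than expert review · nothing below is attributed to [Hironaka2017].

THE OBJECT.  The pencil `F_λ = z·w·A² + λ·B·C` with `A = xy − zw`, `B = y³ − x²z`, `C = x³ − y²w` (𝔾ₘ-weights `(2,3,5,0)`, weighted degree 15,
ordinary degree 6), double along the monomial curve `Z = cl{[t²:t³:t⁵:1]} = V(A,B,C)`; R26 Table 1: `B235/c₁` is `λ = 1`, `B235/c₂` is `λ = −2`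
(theorems `table_c1`, `table_c2`).  `F_λ` is fixed by the involution `ι : (x,y,z,w) ↦ (y,x,w,z)` (theorem `involution`), which swaps the two cusps
`P₀ = [0:0:0:1]`, `e_z = [0:0:1:0]` of `Z`; so the SINK side of the walk is the `ι`-image of the SOURCE side and only source charts are listed
(theorem `sink_chart`).  The host quadric `Q = V(A) ≅ ℙ¹×ℙ¹` contains `Z` as a curve of bidegree `(2,3)` (theorems `segre_*`).
THE WORD (pattern (λ) «satellite line» of R28, 7 blow-ups, every letter a blob₂ Q-level clause with `E ≡ ∅`, each nose tail closed at once):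
  `(pt)@P₀ · (pt)@e_z · FREE@Z^st · FREE@ℓ_src^st · FREE@ℓ_snk^st · (pt)@p_src · (pt)@p_snk · END regular`,
where `ℓ = E_{P₀} ∩ St H` (set-theoretically; `T₁·E_P = 3ℓ`) is the SATELLITE LINE = the tangent line of `Z^st` at `z₀ = Z^st ∩ E_{P₀}` (contact 2),
and `p_src` is the cone point (cone over a smooth plane cubic) appearing on the fibre of `E_ℓ` over `z₀`.
WHAT THIS FILE CERTIFIES (kernel, `ring`/`norm_num`/`field_simp` only): for every chart of the source side the identity
`parent(chart substitution) = (exceptional coordinate)^k · child` with the printed `k` (so the printed polynomials ARE the strict transforms), the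
adapted-coordinate shifts, 𝔾ₘ-homogeneity, the traces on the exceptional divisors (`T₁∩E_P = 3ℓ`, `T′∩E_Z`, `T″∩E_ℓ`), the memberships
`St1 ∈ I_ℓ²`, `G1 ∈ I_{Z^st}²`, `L1 ∈ I_{ℓ^st}²` by explicit decompositions, the restrictions to the host surface `St Q` and its transforms, the
transition identity giving `(ℓ^st)²_{E_P′} = −1`, and the intersection arithmetic feeding the host lemma (memo §4).  All identities hold for every `λ`.
WHAT IT DOES NOT CERTIFY (kit jobs j329146/j329179, Sage/Singular over ℚ, ℚ(λ), ℚ[λ] (elimination) and GF(p); memo §7): that the named loci are ALL of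
`Sing` at each stage, regularity of the final charts, smoothness of the cubic cone, `rad Sing(F_λ) = I_Z`, and the bad set `λ(16λ+1) = 0`.
-/

set_option linter.style.longLine false
set_option linter.unusedVariables false
set_option linter.dupNamespace false
set_option maxRecDepth 2000

namespace Summit.ResolutionOfSingularities.ResolutionOfSingularities.Cruxes.EquisingularLiftNatThree.GmNosesB235R29

/-! §0 The pencil. -/

/-- `A = xy − zw` (the host quadric `Q = V(A)`). -/
def A (x y z w : ℚ) : ℚ := x*y - z*w
/-- `B = y³ − x²z`. -/
def B (x y z w : ℚ) : ℚ := y^3 - x^2*z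
/-- `C = x³ − y²w`. -/
def C (x y z w : ℚ) : ℚ := x^3 - y^2*w

/-- the pencil member `F_λ`, expanded (`l` = λ). -/
def F (l x y z w : ℚ) : ℚ := z^3*w^3 + (-2 : ℚ)*x*y*z^2*w^2 + x^2*y^2*z*w - y^5*w*l + x^2*y^2*z*w*l + x^3*y^3*l - x^5*z*l

/-- two-term structure: `F_λ = zw·A² + λ·BC`; hence `F_λ ∈ I_Z²`, `I_Z = (A,B,C)`. -/
theorem pencil (l x y z w : ℚ) : F l x y z w = z*w*(A x y z w)^2 + l*(B x y z w * C x y z w) := by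
  unfold F A B C; ring

/-- 𝔾ₘ-invariance for the weights `(2,3,5,0)`: weighted degree 15. -/
theorem F_weights (l t x y z w : ℚ) : F l (t^2*x) (t^3*y) (t^5*z) w = t^15 * F l x y z w := by
  unfold F; ring

/-- ordinary homogeneity: degree 6. -/
theorem F_homog (l t x y z w : ℚ) : F l (t*x) (t*y) (t*z) (t*w) = t^6 * F l x y z w := by
  unfold F; ring

/-- the involution `ι : (x,y,z,w) ↦ (y,x,w,z)` fixes every member of the pencil (it swaps `B ↔ −C`... precisely `A∘ι = A`, `B∘ι = −C·(−1)`: checked on `F`). -/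
theorem involution (l x y z w : ℚ) : F l y x w z = F l x y z w := by
  unfold F; ring

/-- `Z = cl{[t²:t³:t⁵:1]}` lies on `A = B = C = 0`. -/
theorem Z_on_ABC (t : ℚ) : A (t^2) (t^3) (t^5) 1 = 0 ∧ B (t^2) (t^3) (t^5) 1 = 0 ∧ C (t^2) (t^3) (t^5) 1 = 0 := by
  unfold A B C; exact ⟨by ring, by ring, by ring⟩

/-- both cusps of `Z` lie on the host quadric: `A(P₀) = A(e_z) = 0` (and trivially `F_λ` vanishes there). -/
theorem poles_on_Q (l : ℚ) : A 0 0 0 1 = 0 ∧ A 0 0 1 0 = 0 ∧ F l 0 0 0 1 = 0 ∧ F l 0 0 1 0 = 0 := by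
  unfold A F; norm_num

/-- R26 Table 1, family B235, vector `c1 = (1, -1, -2, 2, 1, -1)`: the member `λ = 1`. -/
theorem table_c1 (x y z w : ℚ) : F 1 x y z w = z^3*w^3 - y^5*w - 2*x*y*z^2*w^2 + 2*x^2*y^2*z*w + x^3*y^3 - x^5*z := by
  unfold F; ring

/-- R26 Table 1, family B235, vector `c2 = (1, 2, -2, -1, -2, 2)`: the member `λ = -2`. -/
theorem table_c2 (x y z w : ℚ) : F (-2 : ℚ) x y z w = z^3*w^3 + 2*y^5*w - 2*x*y*z^2*w^2 - x^2*y^2*z*w - 2*x^3*y^3 + 2*x^5*z := by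
  unfold F; ring

/-! §0′ The host quadric `Q = V(xy − zw) ≅ ℙ¹×ℙ¹` (Segre `x = s₀t₀, y = s₁t₁, z = s₁t₀, w = s₀t₁`): `Z = V(g)`, `g = s₁²t₁³ − s₀²t₀³` of bidegree `(2,3)`,
`H_λ·Q = L₀ + L_∞ + 2Z` with the rulings `L₀ = V(s₁) = V(y,z) ∋ P₀`, `L_∞ = V(s₀) = V(x,w) ∋ e_z`.  Consequences used in memo §4: `Z²_Q = 2·2·3 = 12`,
`p_a(Z) = (2−1)(3−1) = 2` (the two cusps), `(Z^st)²_{St Q} = 12 − 2² − 2² = 4`, `St Q·Z^st = 2·5 − 2 − 2 = 6`, `deg N_{Z^st/F₂} = 4 + 6 = 10 = 4·5 − 2·2 − 2·2 − 2`. -/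

theorem segre_A (s0 s1 t0 t1 : ℚ) : A (s0*t0) (s1*t1) (s1*t0) (s0*t1) = 0 := by unfold A; ring
theorem segre_B (s0 s1 t0 t1 : ℚ) : B (s0*t0) (s1*t1) (s1*t0) (s0*t1) = s1 * (s1^2*t1^3 - s0^2*t0^3) := by unfold B; ring
theorem segre_C (s0 s1 t0 t1 : ℚ) : C (s0*t0) (s1*t1) (s1*t0) (s0*t1) = -(s0 * (s1^2*t1^3 - s0^2*t0^3)) := by unfold C; ring
/-- `F_λ|_Q = −λ·s₀·s₁·g²`: `H_λ ∩ Q = L₀ + L_∞ + 2Z`. -/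
theorem segre_F (l s0 s1 t0 t1 : ℚ) : F l (s0*t0) (s1*t1) (s1*t0) (s0*t1) = -(l * s0 * s1 * (s1^2*t1^3 - s0^2*t0^3)^2) := by unfold F; ring
/-- the parametrisation of `Z` on `Q`: `(s₀:s₁) = (1:t³)`, `(t₀:t₁) = (t²:1)` gives `(t², t³, t⁵, 1)`. -/
theorem segre_Z (t : ℚ) : ((1:ℚ)*t^2, t^3*1, t^3*t^2, (1:ℚ)*1) = (t^2, t^3, t^5, (1:ℚ)) := by norm_num; ring

/-- intersection arithmetic of the host lemma (memo §4), recorded as checked numerals: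
`Z²_Q = 12`, `(Z^st)² = 4`, `St Q·Z^st = 6`, their sum `10 = deg N_{Z^st/F₂} = deg(−K_{F₂})·Z^st − 2 = (4·5 − 2·2 − 2·2) − 2`;
`(ℓ^st)²_{E_P′} = 1 − 2 = −1`, `E_P′·ℓ^st = −1`, sum `−2 = deg N_{ℓ^st/F₃} = (−K_{F₃})·ℓ^st − 2 = (2 − 2) − 2` (`−K_{F₂}·ℓ = 2`, `E_Z·ℓ^st = 2` = the contact). -/
theorem host_arithmetic :
    (2*2*3 : ℤ) = 12 ∧ (12 - 2^2 - 2^2 : ℤ) = 4 ∧ (2*5 - 2 - 2 : ℤ) = 6 ∧ (4 + 6 : ℤ) = (4*5 - 2*2 - 2*2) - 2 ∧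
    (1 - 2 : ℤ) = -1 ∧ ((-1) + (-1) : ℤ) = (2 - 2) - 2 ∧ ((2:ℤ) - 1) * (3 - 1) = 2 := by norm_num

/-- LAW R29-B (contact criterion), the arithmetic: if `ℓ ⊂ E_P ≅ ℙ²` is a line with `length(ℓ ∩ Z^st) = c`, then after the `Z^st` round
`deg N_{ℓ^st} = (ℓ² − c) + (E_P·ℓ) = (1 − c) − 1 = −c`, and both summands are `≥ −1` iff `c ≤ 2`. Instances `c = 0,1,2,3`. -/
theorem contact_law : (∀ c : ℤ, (1 - c) + (-1) = -c) ∧ ((1:ℤ) - 2 ≥ -1) ∧ ¬ ((1:ℤ) - 3 ≥ -1) := by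
  refine ⟨fun c => by ring, by norm_num, by norm_num⟩

/-! §1 SOURCE pole `P₀ = [0:0:0:1]`, chart `w = 1`. -/

/-- `fsrc` in coordinates `('x', 'y', 'z')`, weights `(2, 3, 5)` — `F_λ(x,y,z,1)`; `P₀` = origin has multiplicity 3 with tangent cone `z³` (the osculating plane `z = 0` of the cusp, tripled). -/
def fsrc (l p q r : ℚ) : ℚ := r^3 + (-2 : ℚ)*p*q*r^2 + p^2*q^2*r - q^5*l + p^2*q^2*r*l + p^3*q^3*l - p^5*r*l

theorem fsrc_eq_F (l p q r : ℚ) : fsrc l p q r = F l p q r 1 := by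
  unfold fsrc F; ring

/-- weighted homogeneity of `fsrc`: weights `(2, 3, 5)`, degree `15`. -/
theorem fsrc_weights (l t p q r : ℚ) : fsrc l (t^2*p) (t^3*q) (t^5*r) = t^15 * fsrc l p q r := by
  unfold fsrc; ring

theorem fsrc_cubic_part (l p q r : ℚ) : fsrc l p q r = r^3 + (-(2:ℚ)*p*q*r^2 + p^2*q^2*r - l*q^5 + l*p^2*q^2*r + l*p^3*q^3 - l*p^5*r) := by
  unfold fsrc; ring

/-- the sink chart `z = 1` in coordinates `(x′,y′,w′)` IS the source chart with `x ↔ y`: `F_λ(p,q,1,r) = fsrc(q,p,r)` — the involution at chart level. -/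
theorem sink_chart (l p q r : ℚ) : F l p q 1 r = fsrc l q p r := by
  unfold fsrc F; ring

/-! L1 = (pt)@P₀: the three charts of the point blow-up. -/

/-- `St1` in coordinates `('x', 'y₁', 'z₁')`, weights `(2, 1, 3)` — (pt)@P₀, chart `x` (`y = y₁x, z = z₁x`): `E_P = {x = 0}`, `T₁ ∩ E_P = 3ℓ` with `ℓ = {x = z₁ = 0}`; `Z^st = (y₁², y₁, y₁³)` is TANGENT to `ℓ` at `z₀` = origin. -/
def St1 (l p q r : ℚ) : ℚ := r^3 + (-2 : ℚ)*p*q*r^2 + p^2*q^2*r - p^3*r*l + p^2*q^2*r*l + p^3*q^3*l - p^2*q^5*l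

theorem St1_chart (l p q r : ℚ) : fsrc l p (q*p) (r*p) = p^3 * St1 l p q r := by
  unfold fsrc St1; ring

/-- weighted homogeneity of `St1`: weights `(2, 1, 3)`, degree `9`. -/
theorem St1_weights (l t p q r : ℚ) : St1 l (t^2*p) (t*q) (t^3*r) = t^9 * St1 l p q r := by
  unfold St1; ring

theorem St1_trace (l p q r : ℚ) : St1 l 0 q r = r^3 := by
  unfold St1; ring

/-- `St1 ∈ I_ℓ²`, `I_ℓ = (x, z₁)`: explicit decomposition `x²·(…) + x z₁·(…) + z₁²·(…)` (so `T₁` is singular along `ℓ`). -/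
theorem St1_in_Iell_sq (l p q r : ℚ) : St1 l p q r = p^2*(q^2*r - p*r*l + q^2*r*l + p*q^3*l - q^5*l) + p*r*((-2 : ℚ)*q*r) + r^2*(r) := by
  unfold St1; ring

/-- HOST: `St Q = V(x y₁ − z₁)` in chart `x`; `T₁|_{St Q} = −λ·x²·y₁·(x − y₁²)²` = `2ℓ + L₀^st + 2Z^st` on the smooth surface `St Q` (coordinates `(x, y₁)`). -/
theorem St1_on_StQ (l p q r : ℚ) : St1 l p q (p*q) = -(l * p^2 * q * (p - q^2)^2) := by
  unfold St1; ring

/-- `St1y` in coordinates `('x₁', 'y', "z₁'")`, weights `(-1, 3, 2)` — (pt)@P₀, chart `y` (`x = x₁y, z = z₁′y`): `E_P = {y = 0}`, `ℓ = {y = z₁′ = 0}`; its far point `f₀` = origin has multiplicity 2, tangent cone `−λy²`; transversal type along `ℓ`: the cusp `λy² = z₁′³·(unit)`. -/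
def St1y (l p q r : ℚ) : ℚ := r^3 - q^2*l + (-2 : ℚ)*p*q*r^2 + p^2*q^2*r + p^2*q^2*r*l + p^3*q^3*l - p^5*q^3*r*l

theorem St1y_chart (l p q r : ℚ) : fsrc l (p*q) q (r*q) = q^3 * St1y l p q r := by
  unfold fsrc St1y; ring

theorem St1y_trace (l p q r : ℚ) : St1y l p 0 r = r^3 := by
  unfold St1y; ring

theorem St1y_on_StQ (l p q r : ℚ) : St1y l p q (p*q) = -(l * q^2 * (1 - p^3*q)^2) := by
  unfold St1y; ring

/-- `St1z` in coordinates `("x₁'", "y₁'", 'z')`, weights `(-3, -2, 5)` — (pt)@P₀, chart `z`: constant term 1 — the strict transform misses `E_P` in this chart. -/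
def St1z (l p q r : ℚ) : ℚ := 1 + (-2 : ℚ)*p*q*r + p^2*q^2*r^2 + p^2*q^2*r^2*l - q^5*r^2*l - p^5*r^3*l + p^3*q^3*r^3*l

theorem St1z_chart (l p q r : ℚ) : fsrc l (p*r) (q*r) r = r^3 * St1z l p q r := by
  unfold fsrc St1z; ring

theorem St1z_misses (l p q r : ℚ) : St1z l p q 0 = 1 := by
  unfold St1z; ring

/-! Adapted coordinates at `z₀` and L3 = FREE round @`Z^st` (after L2 = (pt)@e_z, which is the `ι`-image of L1 and touches nothing here). -/

/-- `G1` in coordinates `('X', 'y₁', 'V')`, weights `(2, 1, 3)` — adapted coordinates `X = x − y₁²`, `V = z₁ − y₁³` on chart `x`: `Z^st = {X = V = 0}`, `ℓ = {X = −y₁², V = −y₁³}`, `E_P = St E_P = {X + y₁² = 0}`. -/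
def G1 (l p q r : ℚ) : ℚ := r^3 + (-2 : ℚ)*p*q*r^2 + q^3*r^2 + p^2*q^2*r - p^3*r*l + (-2 : ℚ)*p*q^4*r + (-2 : ℚ)*p^2*q^2*r*l - p*q^4*r*l + p^2*q^5

theorem G1_def' (l p q r : ℚ) : St1 l (p + q^2) q (r + q^3) = G1 l p q r := by
  unfold St1 G1; ring

/-- weighted homogeneity of `G1`: weights `(2, 1, 3)`, degree `9`. -/
theorem G1_weights (l t p q r : ℚ) : G1 l (t^2*p) (t*q) (t^3*r) = t^9 * G1 l p q r := by
  unfold G1; ring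

/-- `G1 ∈ I_{Z^st}² = (X,V)²` explicitly; the transversal quadratic form is `y₁³·(y₁²X² − (2+λ)y₁XV + V²)`, discriminant `λ(λ+4)·y₁⁸`. -/
theorem G1_in_IZst_sq (l p q r : ℚ) : G1 l p q r = p^2*(q^2*r - p*r*l + (-2 : ℚ)*q^2*r*l + q^5) + p*r*((-2 : ℚ)*q*r + (-2 : ℚ)*q^4 - q^4*l) + r^2*(r + q^3) := by
  unfold G1; ring

theorem G1_disc (l p q r : ℚ) : ((-(2:ℚ) - l)*q^4)^2 - 4*(q^5)*(q^3) = l*(l + 4)*q^8 := by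
  ring

/-- `TA` in coordinates `('X', 'y₁', 'V₁')`, weights `(2, 1, 1)` — FREE round @`Z^st`, chart `u` (`V = V₁X`, exceptional `X`): `E_Z = {X = 0}`; `Sing = ℓ^st = {X = −y₁², V₁ = y₁}` exactly (kit B3u). -/
def TA (l p q r : ℚ) : ℚ := p*r^3 + (-2 : ℚ)*p*q*r^2 + p*q^2*r - p^2*r*l + q^3*r^2 + (-2 : ℚ)*q^4*r + q^5 + (-2 : ℚ)*p*q^2*r*l - q^4*r*l

theorem TA_chart (l p q r : ℚ) : G1 l p q (r*p) = p^2 * TA l p q r := by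
  unfold G1 TA; ring

/-- weighted homogeneity of `TA`: weights `(2, 1, 1)`, degree `5`. -/
theorem TA_weights (l t p q r : ℚ) : TA l (t^2*p) (t*q) (t*r) = t^5 * TA l p q r := by
  unfold TA; ring

/-- `T′ ∩ E_Z` in chart `u`: `3·(fibre over z₀) + two 𝔾ₘ-invariant sections V₁ = s_± y₁`, `s² − (2+λ)s + 1 = 0` (not used by the word). -/
theorem TA_trace (l p q r : ℚ) : TA l 0 q r = q^3 * (r^2 - (2 + l)*q*r + q^2) := by
  unfold TA; ring

/-- HOST after the round: `St Q′ = V(V₁ − y₁)` in chart `u` (`x y₁ − z₁ = X·(y₁ − V₁)`), and `T′|_{St Q′} = −λ·y₁·(X + y₁²)²` = `2ℓ^st + L₀^st`: `ℓ^st ⊂ St Q′` too. -/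
theorem StQ_in_G1_coords (l p q r : ℚ) : (p + q^2)*q - (r + q^3) = p*q - r := by
  ring

theorem TA_on_StQ (l p q r : ℚ) : TA l p q q = -(l * q * (p + q^2)^2) := by
  unfold TA; ring

/-- `TB` in coordinates `('X₁', 'y₁', 'V')`, weights `(-1, 1, 3)` — FREE round @`Z^st`, chart `v` (`X = X₁V`, exceptional `V`): linear term `V` (regular at the origin); `Sing = ℓ^st ∩ chart v ⊂ D(X₁V) ⊂ chart u` (kit B3v). -/
def TB (l p q r : ℚ) : ℚ := r + q^3 + (-2 : ℚ)*p*q*r + (-2 : ℚ)*p*q^4 + p^2*q^2*r - p*q^4*l + (-2 : ℚ)*p^2*q^2*r*l - p^3*r^2*l + p^2*q^5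

theorem TB_chart (l p q r : ℚ) : G1 l (p*r) q r = r^2 * TB l p q r := by
  unfold G1 TB; ring

theorem TB_linear (l p q r : ℚ) : TB l p q r = r * (1 - 2*p*q + p^2*q^2 - 2*l*p^2*q^2 - l*p^3*r) + q^3 * (1 - (2 + l)*p*q + p^2*q^2) := by
  unfold TB; ring

theorem TB_trace (l p q r : ℚ) : TB l p q 0 = q^3 * (1 - (2 + l)*p*q + p^2*q^2) := by
  unfold TB; ring

/-! L4 = FREE re-entry round @`ℓ^st` (and L5 = its `ι`-image at the sink). Adapted coordinates `a₁ = X + y₁² (= x)`, `c₁ = V₁ − y₁` on chart `u`. -/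

/-- `L1` in coordinates `('a₁', 'y₁', 'c₁')`, weights `(2, 1, 1)` — `ℓ^st = {a₁ = c₁ = 0}`; `E_P′ = {a₁ = 0}` (smooth, coordinates `(y₁, c₁)`), `St Q′ = {c₁ = 0}`: `ℓ^st = E_P′ ∩ St Q′` in this chart. -/
def L1 (l p q r : ℚ) : ℚ := p*r^3 + p*q*r^2 - p^2*r*l - p^2*q*l - q^2*r^3

theorem L1_def' (l p q r : ℚ) : TA l (p - q^2) q (r + q) = L1 l p q r := by
  unfold TA L1; ring

/-- weighted homogeneity of `L1`: weights `(2, 1, 1)`, degree `5`. -/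
theorem L1_weights (l t p q r : ℚ) : L1 l (t^2*p) (t*q) (t*r) = t^5 * L1 l p q r := by
  unfold L1; ring

/-- `L1 ∈ I_{ℓ^st}² = (a₁,c₁)²` explicitly (so `T′` is singular along `ℓ^st`). -/
theorem L1_in_Iellst_sq (l p q r : ℚ) : L1 l p q r = p^2*(-r*l - q*l) + p*r*(r^2 + q*r) + r^2*(-q^2*r) := by
  unfold L1; ring

/-- `LA` in coordinates `('a₁', 'y₁', 'c₁₁')`, weights `(2, 1, -1)` — round @`ℓ^st`, chart `u′` (`c₁ = c₁₁a₁`, exceptional `a₁`): `E_ℓ = {a₁ = 0}`; REGULAR (kit B4u′). -/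
def LA (l p q r : ℚ) : ℚ := -q*l - p*r*l + p*q*r^2 + p^2*r^3 - p*q^2*r^3

theorem LA_chart (l p q r : ℚ) : L1 l p q (r*p) = p^2 * LA l p q r := by
  unfold L1 LA; ring

/-- `T″ ∩ E_ℓ` in chart `u′` is `−λ·y₁`: the fibre of `E_ℓ → ℓ^st` over `z₀`, reduced. -/
theorem LA_trace (l p q r : ℚ) : LA l 0 q r = -(l*q) := by
  unfold LA; ring

/-- `LB` in coordinates `('a₁₁', 'y₁', 'c₁')`, weights `(1, 1, 1)` — round @`ℓ^st`, chart `v′` (`a₁ = a₁₁c₁`, exceptional `c₁`): a HOMOGENEOUS CUBIC in `(a₁₁, y₁, c₁)` — `p_src` = origin is the cone over a plane cubic (smooth iff `λ(16λ+1) ≠ 0`, kit B4v′/elim); `Sing = {p_src}` (kit). -/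
def LB (l p q r : ℚ) : ℚ := -q^2*r + p*r^2 + p*q*r - p^2*r*l - p^2*q*l

theorem LB_chart (l p q r : ℚ) : L1 l (p*r) q r = r^2 * LB l p q r := by
  unfold L1 LB; ring

/-- weighted homogeneity of `LB`: weights `(1, 1, 1)`, degree `3`. -/
theorem LB_weights (l t p q r : ℚ) : LB l (t*p) (t*q) (t*r) = t^3 * LB l p q r := by
  unfold LB; ring

theorem LB_trace (l p q r : ℚ) : LB l p q 0 = -(l*p^2*q) := by
  unfold LB; ring

/-! L6 = (pt)@`p_src` (and L7 = its `ι`-image): the three charts of the point blow-up of the cone; each is regular (kit B5). -/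

/-- `LBa` in coordinates `('a₁₁', 'y₁', 'c₁')` — (pt)@p_src, chart `a₁₁`: regular (kit B5); note the linear term. -/
def LBa (l p q r : ℚ) : ℚ := -r*l + r^2 - q*l + q*r - q^2*r

theorem LBa_chart (l p q r : ℚ) : LB l p (q*p) (r*p) = p^3 * LBa l p q r := by
  unfold LB LBa; ring

/-- `LBy` in coordinates `('a₁₁', 'y₁', 'c₁')` — (pt)@p_src, chart `y₁`: regular (kit B5); note the linear term. -/
def LBy (l p q r : ℚ) : ℚ := -r + p*r + p*r^2 - p^2*l - p^2*r*l

theorem LBy_chart (l p q r : ℚ) : LB l (p*q) q (r*q) = q^3 * LBy l p q r := by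
  unfold LB LBy; ring

/-- `LBc` in coordinates `('a₁₁', 'y₁', 'c₁')` — (pt)@p_src, chart `c₁`: regular (kit B5); note the linear term. -/
def LBc (l p q r : ℚ) : ℚ := p - q^2 + p*q - p^2*l - p^2*q*l

theorem LBc_chart (l p q r : ℚ) : LB l (p*r) (q*r) r = r^3 * LBc l p q r := by
  unfold LB LBc; ring

/-! The far point `f₀` of `ℓ` (chart `y` of L1): there `Bl_{Z^st}` is an isomorphism (on `D(g)`), so the `ℓ^st` round is computed from `St1y` directly. -/

/-- `MA` in coordinates `('x₁', "y'", "z₁'")`, weights `(-1, 1, 2)` — round @`ℓ` from chart `y`, subchart `y = y′z₁′` (exceptional `z₁′`): `E_ℓ = {z₁′ = 0}`, `T″ ∩ E_ℓ = −λy′²` (the double section = `E_ℓ ∩ St E_P`... as a set); REGULAR on `D(g)` (kit B6): the linear term `z₁′` has coefficient `1` along `E_ℓ ∩ T″ = {z₁′ = y′ = 0}`. -/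
def MA (l p q r : ℚ) : ℚ := r - q^2*l + (-2 : ℚ)*p*q*r + p^2*q^2*r + p^2*q^2*r*l + p^3*q^3*r*l - p^5*q^3*r^2*l

theorem MA_chart (l p q r : ℚ) : St1y l p (q*r) r = r^2 * MA l p q r := by
  unfold St1y MA; ring

theorem MA_linear (l p q r : ℚ) : MA l p q r = -(l*q^2) + r * (1 - 2*p*q + p^2*q^2 + l*p^2*q^2 + l*p^3*q^3 - l*p^5*q^3*r) := by
  unfold MA; ring

/-- `MB` in coordinates `('x₁', 'y', "z''")`, weights `(-1, 3, -1)` — round @`ℓ` from chart `y`, subchart `z₁′ = z″y` (exceptional `y`): constant term `−λ`, misses `E_ℓ`; REGULAR on `D(g)` (kit B6). -/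
def MB (l p q r : ℚ) : ℚ := -l + q*r^3 + (-2 : ℚ)*p*q*r^2 + p^2*q*r + p^2*q*r*l + p^3*q*l - p^5*q^2*r*l

theorem MB_chart (l p q r : ℚ) : St1y l p q (r*q) = q^2 * MB l p q r := by
  unfold St1y MB; ring

theorem MB_const (l p q r : ℚ) : MB l p 0 r = -l := by
  unfold MB; ring

/-! §2 The transition identity behind `(ℓ^st)²_{E_P′} = −1` (memo §4, application 2).
On `E_P′ = {X = −y₁²}` (chart `u`), `z₁ = V + y₁³ = V₁X + y₁³ = −y₁²(V₁ − y₁) = −y₁²·c₁`; the far chart's conormal generator of `ℓ ⊂ E_P` is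
`z₁′ = z/y = z₁/y₁`, the near chart's is `c₁`; hence `z₁′ = −y₁·c₁` on the overlap `y₁ ≠ 0`: the global section `c₁` of `N^∨_{ℓ^st/E_P′}` equals
`−x₁·z₁′` near `f₀` (`x₁ = 1/y₁`) and has exactly one simple zero (at `f₀`), so `deg N^∨ = 1`, `(ℓ^st)² = −1`. -/

theorem ellst_transition (y1 c1 : ℚ) (hy : y1 ≠ 0) : ((c1 + y1) * (-y1^2) + y1^3) / y1 = -(y1 * c1) := by
  field_simp
  ring

theorem ellst_transition' (y1 c1 : ℚ) : -(y1 * c1) = -((1 / y1)⁻¹ * c1) := by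
  rw [one_div, inv_inv]

/-! §3 𝔾ₘ-localisation cross-check of the degrees (formula of R27 §5: `deg L = (w_∞ − w₀)/c₀`). For `Z^st ⊂ F₂` the conormal generators at `z₀`
have weights `(2,3)` (`X`, `V`) with tangent weight `1` (`y₁`), and at the sink end the opposite weights by `ι`-symmetry: `deg N^∨ = −4 + (−6) = −10` or
`(−5,−5)` depending on the pairing — either way `deg N_{Z^st/F₂} = 10 = 4 + 6`. -/

def degLoc (w0 winf c0 : ℚ) : ℚ := (winf - w0) / c0
example : degLoc 2 (-2) 1 + degLoc 3 (-3) 1 = -10 := by norm_num [degLoc]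
example : degLoc 2 (-3) 1 + degLoc 3 (-2) 1 = -10 := by norm_num [degLoc]

end Summit.ResolutionOfSingularities.ResolutionOfSingularities.Cruxes.EquisingularLiftNatThree.GmNosesB235R29
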